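import Mathlib
import Summits.Ventures.PercRepro2.SwOutShadowMultiRootIneq
import Summits.Ventures.PercRepro2.SwOutMultiRootThm

/-!
# The rigid inequality on a part from decorated cubes (blind cell PercRepro2, night-4 g35,
2026-08-29; proofs/NIGHT4-G35.md §3)

g34's block decomposition of a part (`rigidOK_g_of_blocks_part`) with the DECORATED cubes as
blocks: if every side point `ζ` of a part `P` of the general doubly typed side of a class `(U, ξ)`
carries a decorated base — `h` a root, `X` outside its hull, the units inside `U` — whose cube is
the block of `ζ`, and every side point of that block lies in the part with the same key, then the
rigid counting inequality holds on the part: **`rigidOK_g_of_decoCubes`**.  This is the shape the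
multi-root SHADOW takes on the fibres of the escaping set (NIGHT4-G34.md §8 (a)): the parts are the
fibres, the keys the decorated bases of their points (the canonical decorated base at a side point
is the next file's matter).
-/

namespace Summit.Ventures.PercRepro2

namespace LocRows

open Hull

universe u v

variable {V : Type u} {E : Type v} [Fintype E] [DecidableEq E]

open scoped Classical

variable {ends : E → Sym2 V} {U : Set V} {ξ : Config E} {l h : V}
  {𝓤 𝓓 𝓓'' : Set (Set V)} {X : Set V} {𝓤' : Set (Set V)}

/-- **The rigid inequality on a part from decorated cubes**: every side point of the part lies in
its block, every side point of a block lies in the part with the same key, and every block is the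
decorated cube of a decorated base with `h` a root and `X` outside its hull. -/
theorem rigidOK_g_of_decoCubes (h𝓤 : IsUpperSet 𝓤) (h𝓓 : IsLowerSet 𝓓) (h𝓓'' : IsLowerSet 𝓓'')
    (h𝓤' : IsUpperSet 𝓤') {K : Type*} (key : Config E → K) (block : K → Finset (Config E))
    (P : Config E → Prop)
    (hmem : ∀ ζ ∈ gOutSide ends l h 𝓤 𝓓 𝓓'' X 𝓤' U ξ, P ζ → ζ ∈ block (key ζ))
    (hblock : ∀ ζ ∈ gOutSide ends l h 𝓤 𝓓 𝓓'' X 𝓤' U ξ, P ζ → ∀ ζ' ∈ block (key ζ),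
      ζ' ∈ gTypedQ ends l h 𝓤 𝓓 𝓓'' X 𝓤' →
        ζ' ∈ gOutSide ends l h 𝓤 𝓓 𝓓'' X 𝓤' U ξ ∧ P ζ' ∧ key ζ' = key ζ)
    (hcube : ∀ ζ ∈ gOutSide ends l h 𝓤 𝓓 𝓓'' X 𝓤' U ξ, P ζ →
      ∃ (ι : Type u) (_ : Fintype ι) (b : Config E) (R H : Set V) (A Z : ι → Set V) (RR : Finset E),
        DecoBaseE ends b R H l A Z RR ∧ h ∈ R ∧ (∀ x ∈ X, x ∉ H) ∧
          block (key ζ) = decoCubeRR ends A Z RR b)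
    {𝓔 : Set (Set E)} (h𝓔 : IsUpperSet 𝓔) :
    ((gOutSide ends l h 𝓤 𝓓 𝓓'' X 𝓤' U ξ).filter fun ζ => P ζ ∧ redEdges ends ζ h ∈ 𝓔).card ≤
      ((gOutSide ends l h 𝓤 𝓓 𝓓'' X 𝓤' U ξ).filter fun ζ => P ζ ∧ blueEdges ends ζ h ∈ 𝓔).card := by
  refine rigidOK_g_of_blocks_part key block P hmem hblock ?_ h𝓔
  intro ζ hζ hP 𝓔' h𝓔'
  obtain ⟨ι, _, b, R, H, A, Z, RR, hb, hh, hX, hblk⟩ := hcube ζ hζ hP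
  rw [hblk]
  exact hb.card_decoCubeRR_le_g hh h𝓤 h𝓓 h𝓓'' h𝓤' hX h𝓔'

end LocRows

end Summit.Ventures.PercRepro2
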